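import Mathlib
import Summits.ResolutionOfSingularities.ResolutionOfSingularities.Theorems.WeightedInvariantLocalWeightedDropTOT2BridgeOldLetterEntry
import Summits.ResolutionOfSingularities.ResolutionOfSingularities.Theorems.WeightedInvariantLocalWeightedDropConeDichotomyAux
import Literature.AlgebraicGeometry.Resolution.CobordantArcLemma

/-!
# `WeightedInvariant.LocalWeightedDrop`, TOT2-LINE v1.3 piece (P1): **THE STRAIGHT PRESENTATION OF A PRESENTED REGIME STATE** — from the directrix
# form and a free coordinate (`GoodDir`) or the old letter (`O = {l₀}`) to `Θ^* g = U · (y^c + Σ A_j y^j)` with EVERY boundary letter a coordinate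

Crux item stmt-ResolutionOfSingularities-8899 `LocalWeightedDrop` (route `ResolutionOfSingularities/WeightedInvariant`), ENGINE skeleton v33 (candidate
35b29332b4d99231, res-L1-w43-lead-1 g5), registered-to-be stub `stub_regimePresented`; TOT2-LINE v1.3 §3 (P1) ENTRY — the WANT of the registrar
(15:24:08Z): «`∃ Θ U A, legal Θ ∧ (∀ l ∈ E, Θ straightens x_l to a coordinate) ∧ subst Θ g = U·monicForm c A ∧ IsPosT c A` from `IsDirForm δ ℓ` +
independence / `O = {l₀}`».  [OURS · L1 W4.3 · chain w43 · stub worker res-L1-w43-stub-2 (gen 5), dealt (P1) 15:24Z; on res-type-083's Weierstrass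
files, `TschirnhausForm.det_of_offLast_rows`, `AxisNormalize.initEval_subst_linSubst`, and this seat's …TOT2BridgeOldLetterEntry (p542017).  Nothing
here is a statement of any manuscript; AI-produced, gate-checked, weaker than expert review.  Definition-free.]

THE POINT.  The general entry `WeierstrassForm.exists_monicForm` straightens the directrix form `ℓ` by SOME invertible linear change, which may bend the
boundary letters; the decorated assembly needs them straight ((P3) of `IsBPermissible`).  Two cases admit a letter-straightening change:
* `O = {l₀}` (the old letter IS the contact letter): the SWAP `x_{l₀} ↔ y` (…TOT2BridgeOldLetterEntry) — here repackaged in the WANT shape with the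
  label of degree `δ.c` (`exists_straightPresentation_of_O_eq_singleton`; plus `A 0 = 0`);
* `GoodDir` (`O = ∅` and `ℓ_j ≠ 0` for some FREE coordinate `j ∉ E`): the swap `x_j ↔ y` followed by the ROW OPERATION `y ↦ (y − Σ_{i<last} ℓ′_i x_i)/ℓ′_last`
  (identity on every other coordinate — so on every boundary letter), `exists_straightPresentation_of_goodDir`.
Tools: `dotProduct_comp_perm`, `rowOp_*` (the row-operation matrix: determinant `1/ℓ′_last` by `det_of_offLast_rows`, it fixes the letters, `ℓ′ · (M v) = v_last`),
`exists_monicForm_of_lastCone` (letter cone at `y` ⇒ monic form, no change of coordinates), `monicForm_comp_cast` / `isPos_comp_cast` (degree bookkeeping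
`Fin (o+1) ≃ Fin c`).
-/

set_option linter.dupNamespace false -- mandated namespace of this single-conjunct summit

noncomputable section

namespace Summit.ResolutionOfSingularities.ResolutionOfSingularities.Theorems

namespace TameFourTupleDrop

open MvPowerSeries Literature.AlgebraicGeometry.Resolution

variable {k : Type} [Field k] {m : ℕ}

/-! ## Composition of legal coordinate changes (local copies of the plumbing of `…GlobalizeLocalDropCanonize`, kept out of the route's import cone) -/

/-- The components of a composite substitution `θ^*(φ i)` have zero constant terms. -/
private theorem constantCoeff_comp_eq_zero' {n : ℕ} {φ θ : Fin n → MvPowerSeries (Fin n) k}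
    (hφ0 : ∀ i, constantCoeff (φ i) = 0) (hθ0 : ∀ i, constantCoeff (θ i) = 0) (i : Fin n) : constantCoeff (subst θ (φ i)) = 0 :=
  constantCoeff_subst_eq_zero (hasSubst_of_constantCoeff_zero hθ0) hθ0 (hφ0 i)

/-- Chain rule for linear parts: `linMat (θ^* ∘ φ) = linMat φ * linMat θ`. -/
private theorem linMat_comp' {n : ℕ} (φ : Fin n → MvPowerSeries (Fin n) k) {θ : Fin n → MvPowerSeries (Fin n) k}
    (hθ0 : ∀ i, constantCoeff (θ i) = 0) :
    FormalCoordChange.linMat (fun i => subst θ (φ i)) = FormalCoordChange.linMat φ * FormalCoordChange.linMat θ := by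
  ext i j
  simp only [FormalCoordChange.linMat, Matrix.of_apply, Matrix.mul_apply]
  exact CobordantArc.coeff_degree_one_subst θ hθ0 (φ i) _ (Finsupp.degree_single _ _)

/-- Composition of substitutions: `θ^*(φ^* f) = (θ^* ∘ φ)^* f`. -/
private theorem subst_subst_eq_subst_comp' {n : ℕ} {φ θ : Fin n → MvPowerSeries (Fin n) k}
    (hφ0 : ∀ i, constantCoeff (φ i) = 0) (hθ0 : ∀ i, constantCoeff (θ i) = 0) (f : MvPowerSeries (Fin n) k) :
    subst θ (subst φ f) = subst (fun i => subst θ (φ i)) f :=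
  subst_comp_subst_apply (hasSubst_of_constantCoeff_zero hφ0) (hasSubst_of_constantCoeff_zero hθ0) f

/-! ## Degree bookkeeping -/

/-- Re-indexing a label along `d = d′` does not change its monic form. -/
theorem monicForm_comp_cast {d d' : ℕ} (h : d = d') (A : Fin d' → MvPowerSeries (Fin m) k) :
    (X (Fin.last m) ^ d + ∑ j : Fin d, rename (Fin.succAboveEmb (Fin.last m)) (A (Fin.cast h j)) * X (Fin.last m) ^ (j : ℕ)) =
      X (Fin.last m) ^ d' + ∑ j : Fin d', rename (Fin.succAboveEmb (Fin.last m)) (A j) * X (Fin.last m) ^ (j : ℕ) := by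
  subst h; rfl

/-- Nor its positivity. -/
theorem isPos_comp_cast {d d' : ℕ} (h : d = d') {A : Fin d' → MvPowerSeries (Fin m) k}
    (hA : ∀ j : Fin d', ((d' - (j : ℕ) : ℕ) : ℕ∞) < (A j).order) :
    ∀ j : Fin d, ((d - (j : ℕ) : ℕ) : ℕ∞) < (A (Fin.cast h j)).order := by
  subst h; exact hA

/-! ## `O = {l₀}`: the swap presentation in the WANT shape -/

/-- **(P1), CASE `O = {l₀}`** (`k` infinite): a straight presentation of `g = f · x_{l₀}` of degree `c` — `Θ` the swap `x_{l₀} ↔ y` (zero constants,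
invertible linear part, every boundary letter mapped to a letter), `H(0) ≠ 0`, `A` a position, and moreover `A 0 = 0`. -/
theorem exists_straightPresentation_of_O_eq_singleton [Infinite k] {δ : Decoration k m} (hf : δ.f ≠ 0) {l₀ : Fin (m + 1)}
    (hO : δ.O = {l₀}) {la : k} (hla : la ≠ 0) {ℓ : Fin (m + 1) → k} (hℓ : ℓ ≠ 0)
    (hcone : ∀ v : Fin (m + 1) → k,
      CobordantChart.initEval (fun _ : Fin (m + 1) => 1) v δ.c (δ.f * ∏ l' ∈ δ.O, X l') = la * dotProduct ℓ v ^ δ.c) :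
    ∃ (Θ : Fin (m + 1) → MvPowerSeries (Fin (m + 1)) k) (H : MvPowerSeries (Fin (m + 1)) k) (A : Fin δ.c → MvPowerSeries (Fin m) k),
      (∀ i, constantCoeff (Θ i) = 0) ∧ IsUnit (FormalCoordChange.linMat Θ).det ∧
      (∀ l ∈ δ.E, ∃ (l' : Fin (m + 1)) (u : MvPowerSeries (Fin (m + 1)) k), constantCoeff u ≠ 0 ∧ Θ l = u * X l') ∧
      constantCoeff H ≠ 0 ∧ (∀ j : Fin δ.c, ((δ.c - (j : ℕ) : ℕ) : ℕ∞) < (A j).order) ∧ (∀ h0 : 0 < δ.c, A ⟨0, h0⟩ = 0) ∧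
      subst Θ (δ.f * ∏ l' ∈ δ.O, X l') =
        H * (X (Fin.last m) ^ δ.c + ∑ j : Fin δ.c, rename (Fin.succAboveEmb (Fin.last m)) (A j) * X (Fin.last m) ^ (j : ℕ)) := by
  obtain ⟨H, A, hH, hA, hA0, hP⟩ := exists_presentation_swap_of_oldLetter_linearCone hf hO hla hℓ hcone
  have hc : δ.c = δ.o + 1 := (Decoration.prod_O_eq_of_eq_singleton hO).2
  refine ⟨fun i => X (Equiv.swap l₀ (Fin.last m) i), H, fun j => A (Fin.cast hc j), fun _ => constantCoeff_X _,
    NCTransport.isUnit_det_linMat_perm _, fun l _ => ⟨Equiv.swap l₀ (Fin.last m) l, 1, by rw [map_one]; exact one_ne_zero, by rw [one_mul]⟩,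
    hH, isPos_comp_cast hc hA, fun h0 => ?_, ?_⟩
  · have : Fin.cast hc ⟨0, h0⟩ = 0 := Fin.ext rfl
    show A (Fin.cast hc ⟨0, h0⟩) = 0
    rw [this]; exact hA0
  · rw [hP, monicForm_comp_cast hc A]

/-! ## The row operation fixing all coordinates but `y` -/

/-- Permuting a dot product: `ℓ · (v ∘ π) = (ℓ ∘ π⁻¹) · v`; for an involution `π⁻¹ = π`. -/
theorem dotProduct_comp_perm {N : ℕ} (π : Equiv.Perm (Fin N)) (ℓ v : Fin N → k) :
    dotProduct ℓ (fun i => v (π i)) = dotProduct (fun i => ℓ (π.symm i)) v := by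
  rw [dotProduct, dotProduct]
  exact Fintype.sum_equiv π _ _ fun i => by rw [Equiv.symm_apply_apply]

section RowOp

variable {ℓ : Fin (m + 1) → k} {M : Matrix (Fin (m + 1)) (Fin (m + 1)) k}
  (hM : ∀ i j, M i j = if i = Fin.last m then (if j = Fin.last m then (ℓ (Fin.last m))⁻¹ else -(ℓ j / ℓ (Fin.last m)))
    else (if j = i then 1 else 0))
include hM

/-- The row-operation matrix has determinant `1/ℓ_y`. -/
theorem rowOp_det : M.det = (ℓ (Fin.last m))⁻¹ := by
  rw [TschirnhausForm.det_of_offLast_rows M (fun i j hi => by rw [hM, if_neg hi]), hM, if_pos rfl, if_pos rfl]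

/-- It fixes every coordinate other than `y`: `(M v)_i = v_i`. -/
theorem rowOp_mulVec_of_ne (v : Fin (m + 1) → k) {i : Fin (m + 1)} (hi : i ≠ Fin.last m) : M.mulVec v i = v i := by
  classical
  rw [Matrix.mulVec, dotProduct, Finset.sum_eq_single i]
  · rw [hM, if_neg hi, if_pos rfl, one_mul]
  · intro j _ hj; rw [hM, if_neg hi, if_neg hj, zero_mul]
  · intro h; exact absurd (Finset.mem_univ _) h

/-- Its linear substitution fixes every letter other than `y`. -/
theorem rowOp_linSubst_of_ne {i : Fin (m + 1)} (hi : i ≠ Fin.last m) :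
    FormalCoordChange.linSubst M i = (X i : MvPowerSeries (Fin (m + 1)) k) := by
  classical
  unfold FormalCoordChange.linSubst
  rw [Finset.sum_eq_single i]
  · rw [hM, if_neg hi, if_pos rfl, one_smul]
  · intro j _ hj; rw [hM, if_neg hi, if_neg hj, zero_smul]
  · intro h; exact absurd (Finset.mem_univ _) h

/-- And it straightens the directrix form: `ℓ · (M v) = v_y` (`ℓ_y ≠ 0`). -/
theorem dotProduct_rowOp_mulVec (hℓ : ℓ (Fin.last m) ≠ 0) (v : Fin (m + 1) → k) : dotProduct ℓ (M.mulVec v) = v (Fin.last m) := by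
  classical
  have hlast : M.mulVec v (Fin.last m) = (ℓ (Fin.last m))⁻¹ * v (Fin.last m) -
      ∑ j : Fin m, ℓ (Fin.castSucc j) / ℓ (Fin.last m) * v (Fin.castSucc j) := by
    rw [Matrix.mulVec, dotProduct, Fin.sum_univ_castSucc, hM, if_pos rfl, if_pos rfl]
    have h : ∀ j : Fin m, M (Fin.last m) (Fin.castSucc j) * v (Fin.castSucc j) =
        -(ℓ (Fin.castSucc j) / ℓ (Fin.last m) * v (Fin.castSucc j)) := fun j => by
      rw [hM, if_pos rfl, if_neg (Fin.castSucc_lt_last j).ne, neg_mul]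
    rw [Finset.sum_congr rfl (fun j _ => h j), Finset.sum_neg_distrib]
    ring
  rw [dotProduct, Fin.sum_univ_castSucc, hlast]
  have h2 : ∀ j : Fin m, ℓ (Fin.castSucc j) * M.mulVec v (Fin.castSucc j) = ℓ (Fin.castSucc j) * v (Fin.castSucc j) := fun j => by
    rw [rowOp_mulVec_of_ne hM v (Fin.castSucc_lt_last j).ne]
  rw [Finset.sum_congr rfl (fun j _ => h2 j), mul_sub, ← mul_assoc, mul_inv_cancel₀ hℓ, one_mul, Finset.mul_sum]
  have h3 : ∀ j : Fin m, ℓ (Fin.last m) * (ℓ (Fin.castSucc j) / ℓ (Fin.last m) * v (Fin.castSucc j)) =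
      ℓ (Fin.castSucc j) * v (Fin.castSucc j) := fun j => by
    field_simp
  rw [Finset.sum_congr rfl (fun j _ => h3 j)]
  ring

end RowOp

/-! ## A letter cone at `y` gives the monic form with no change of coordinates -/

/-- If `ord F ≥ d` and `in_d F(v) = λ · v_y^d` (`λ ≠ 0`), then `F = H · (y^d + Σ A_j y^j)`, `H(0) ≠ 0`, `ord A_j > d − j` (`k` infinite). -/
theorem exists_monicForm_of_lastCone [Infinite k] (F : MvPowerSeries (Fin (m + 1)) k) (d : ℕ) (hFo : (d : ℕ∞) ≤ F.order) {la : k}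
    (hla : la ≠ 0) (hcone : ∀ v : Fin (m + 1) → k, CobordantChart.initEval (fun _ : Fin (m + 1) => 1) v d F = la * v (Fin.last m) ^ d) :
    ∃ (H : MvPowerSeries (Fin (m + 1)) k) (A : Fin d → MvPowerSeries (Fin m) k),
      constantCoeff H ≠ 0 ∧ (∀ j : Fin d, ((d - (j : ℕ) : ℕ) : ℕ∞) < (A j).order) ∧
      F = H * (X (Fin.last m) ^ d + ∑ j : Fin d, rename (Fin.succAboveEmb (Fin.last m)) (A j) * X (Fin.last m) ^ (j : ℕ)) := by
  obtain ⟨H, A, hH, hA, hFeq⟩ := exists_monicForm_subst_swap_of_cone F d hFo (Fin.last m) hla hcone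
  refine ⟨H, A, hH, hA, ?_⟩
  have hid : (fun i => (X (Equiv.swap (Fin.last m) (Fin.last m) i) : MvPowerSeries (Fin (m + 1)) k)) = X := by
    funext i; rw [Equiv.swap_self, Equiv.refl_apply]
  rw [hid, subst_self] at hFeq
  exact hFeq

/-! ## `GoodDir`: swap the free coordinate to `y`, then the row operation -/

/-- **(P1), CASE `GoodDir`** (`k` infinite): `O = ∅`, `in_c f = λ·(ℓ·v)^c` with `ℓ_j ≠ 0` for a FREE coordinate `j ∉ E` ⇒ a straight presentation
`Θ^* f = H · (y^c + Σ A_j y^j)`: `Θ` = (swap `x_j ↔ y`) ∘ (row operation `y ↦ (y − Σ ℓ′_i x_i)/ℓ′_y`), zero constants, invertible linear part, and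
EVERY boundary letter mapped to a letter; `H(0) ≠ 0`, `A` a position of degree `c`. -/
theorem exists_straightPresentation_of_goodDir [Infinite k] {δ : Decoration k m} (hf : δ.f ≠ 0) (hO : δ.O = ∅)
    {la : k} (hla : la ≠ 0) {ℓ : Fin (m + 1) → k}
    (hcone : ∀ v : Fin (m + 1) → k,
      CobordantChart.initEval (fun _ : Fin (m + 1) => 1) v δ.c (δ.f * ∏ l' ∈ δ.O, X l') = la * dotProduct ℓ v ^ δ.c)
    {j : Fin (m + 1)} (hjE : j ∉ δ.E) (hj : ℓ j ≠ 0) :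
    ∃ (Θ : Fin (m + 1) → MvPowerSeries (Fin (m + 1)) k) (H : MvPowerSeries (Fin (m + 1)) k) (A : Fin δ.c → MvPowerSeries (Fin m) k),
      (∀ i, constantCoeff (Θ i) = 0) ∧ IsUnit (FormalCoordChange.linMat Θ).det ∧
      (∀ l ∈ δ.E, ∃ (l' : Fin (m + 1)) (u : MvPowerSeries (Fin (m + 1)) k), constantCoeff u ≠ 0 ∧ Θ l = u * X l') ∧
      constantCoeff H ≠ 0 ∧ (∀ j : Fin δ.c, ((δ.c - (j : ℕ) : ℕ) : ℕ∞) < (A j).order) ∧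
      subst Θ (δ.f * ∏ l' ∈ δ.O, X l') =
        H * (X (Fin.last m) ^ δ.c + ∑ j : Fin δ.c, rename (Fin.succAboveEmb (Fin.last m)) (A j) * X (Fin.last m) ^ (j : ℕ)) := by
  classical
  -- with `O = ∅` the product is `f` and `c = o`
  have hprod : (∏ l' ∈ δ.O, (X l' : MvPowerSeries (Fin (m + 1)) k)) = 1 := by rw [hO, Finset.prod_empty]
  have hc : δ.c = δ.o := by rw [Decoration.c, hO, Finset.card_empty, add_zero]
  rw [hprod, mul_one] at hcone ⊢
  have hfo : ((δ.c : ℕ) : ℕ∞) ≤ δ.f.order := by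
    rw [hc, Decoration.o, ENat.coe_toNat (by rw [ne_eq, order_eq_top_iff]; exact hf)]
  -- step 1: the swap `x_j ↔ y`
  set σ := Equiv.swap j (Fin.last m) with hσ
  set ℓ' : Fin (m + 1) → k := fun i => ℓ (σ i) with hℓ'
  have hℓ'last : ℓ' (Fin.last m) = ℓ j := by rw [hℓ']; dsimp only; rw [hσ, Equiv.swap_apply_right]
  have hℓ'ne : ℓ' (Fin.last m) ≠ 0 := by rw [hℓ'last]; exact hj
  set F₁ := subst (fun i => (X (σ i) : MvPowerSeries (Fin (m + 1)) k)) δ.f with hF₁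
  have hF₁cone : ∀ v : Fin (m + 1) → k, CobordantChart.initEval (fun _ : Fin (m + 1) => 1) v δ.c F₁ = la * dotProduct ℓ' v ^ δ.c := by
    intro v
    rw [hF₁, initEval_subst_X_perm, hcone, dotProduct_comp_perm, hℓ', hσ, Equiv.symm_swap]
  -- step 2: the row operation
  obtain ⟨M, hM⟩ : ∃ M : Matrix (Fin (m + 1)) (Fin (m + 1)) k, ∀ i j', M i j' =
      if i = Fin.last m then (if j' = Fin.last m then (ℓ' (Fin.last m))⁻¹ else -(ℓ' j' / ℓ' (Fin.last m))) else (if j' = i then 1 else 0) :=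
    ⟨Matrix.of fun i j' => if i = Fin.last m then (if j' = Fin.last m then (ℓ' (Fin.last m))⁻¹ else -(ℓ' j' / ℓ' (Fin.last m)))
      else (if j' = i then 1 else 0), fun _ _ => rfl⟩
  set F₂ := subst (FormalCoordChange.linSubst M) F₁ with hF₂
  have hF₂cone : ∀ v : Fin (m + 1) → k, CobordantChart.initEval (fun _ : Fin (m + 1) => 1) v δ.c F₂ = la * v (Fin.last m) ^ δ.c := by
    intro v
    rw [hF₂, AxisNormalize.initEval_subst_linSubst (Fin.last m), hF₁cone, dotProduct_rowOp_mulVec hM hℓ'ne]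
  have hσ0 : ∀ i, constantCoeff ((fun i => (X (σ i) : MvPowerSeries (Fin (m + 1)) k)) i) = 0 := fun i => constantCoeff_X _
  have hM0 : ∀ i, constantCoeff (FormalCoordChange.linSubst M i) = 0 := ConeDichotomy.constantCoeff_linSubst M
  have hF₂o : ((δ.c : ℕ) : ℕ∞) ≤ F₂.order :=
    ConeDichotomy.le_order_subst_of_le _ hM0 _ _ (ConeDichotomy.le_order_subst_of_le _ hσ0 _ _ hfo)
  obtain ⟨H, A, hH, hA, hF₂eq⟩ := exists_monicForm_of_lastCone F₂ δ.c hF₂o hla hF₂cone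
  -- the composite change
  refine ⟨fun i => subst (FormalCoordChange.linSubst M) (X (σ i)), H, A, constantCoeff_comp_eq_zero' hσ0 hM0, ?_, ?_, hH, hA, ?_⟩
  · rw [linMat_comp' (fun i => (X (σ i) : MvPowerSeries (Fin (m + 1)) k)) hM0, Matrix.det_mul]
    refine (NCTransport.isUnit_det_linMat_perm σ).mul ?_
    change IsUnit (Matrix.of fun i j' => coeff (Finsupp.single j' 1) (FormalCoordChange.linSubst M i)).det
    rw [ConeDichotomy.linMat_linSubst, rowOp_det hM]
    exact isUnit_iff_ne_zero.mpr (inv_ne_zero hℓ'ne)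
  · intro l hl
    have hlj : l ≠ j := fun h => hjE (h ▸ hl)
    have hσl : σ l ≠ Fin.last m := by
      rw [hσ]
      intro h
      by_cases hll : l = Fin.last m
      · rw [hll, Equiv.swap_apply_right] at h
        exact hlj (hll.trans h.symm)
      · rw [Equiv.swap_apply_of_ne_of_ne hlj hll] at h
        exact hll h
    refine ⟨σ l, 1, by rw [map_one]; exact one_ne_zero, ?_⟩
    show subst (FormalCoordChange.linSubst M) (X (σ l)) = 1 * X (σ l)
    rw [subst_X (FormalCoordChange.hasSubst_linSubst M), rowOp_linSubst_of_ne hM hσl, one_mul]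
  · rw [← subst_subst_eq_subst_comp' hσ0 hM0, ← hF₁, ← hF₂, hF₂eq]

end TameFourTupleDrop

end Summit.ResolutionOfSingularities.ResolutionOfSingularities.Theorems

end
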